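import Mathlib
import Literature.MathematicalPhysics.QuantumFieldTheory.Balaban1983to89.TorusGeometry
import Literature.MathematicalPhysics.QuantumFieldTheory.Balaban1983to89.B3Taylor310LocalRemainder

/-!
# `Summit.QuantumFields.Balaban3D.Proofs.CollarCount` — lane «pub-balaban3d» (Bałaban, CMP **102** (1985) 255–275, d = 3 lattice UV
# stability AS PRINTED), prover seat p2: the METRIC BOOKKEEPING of the collar count «|Z_j| ≤ Σ (c_g R(g_i)M₁)³» ((39) p. 266, rule of
# pp. 267–268) on `Setup`'s tori — how the torus distance behaves under the block map `T^{(j)} → T^{(j+1)}`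

HONEST FRAMING (lane PLAN.md §0).  Nothing of [B10] = [Balaban1985UV3] is asserted; pure arithmetic of `ZMod` labels and of the `ℓ¹` torus
distance `Setup.Site.tdist` under `Setup.blockOf` (label `n ↦ n / L`, `TorusGeometry.Site.val_blockOf`), in the standing range
`j + 1 ≤ m + K`.  These are the two inequalities the chain «y ∈ Z_j(h) ⇒ y lies within the accumulated collar widths of a large-field
plaquette of some P_i, i ≤ j» is measured with (seat p1's regions `Carriers.Regions.Omega`, 4D cell `B10LargeFieldSum.cover_chain`):
* `tdist_blockOf_le` — CONTRACTION: `tdist (blockOf x) (blockOf y) ≤ tdist x y / L + d` (coarsening divides distances by `L` up to rounding);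
* `tdist_le_blockOf` — EXPANSION: `tdist x y ≤ L·tdist (blockOf x) (blockOf y) + d(L − 1)` (two fine sites are as far apart as their blocks,
  times `L`, plus the block diameter);
* (`tdist_triangle`, `tdist_comm` are the 4D cell's `B3Taylor310LocalRemainder` lemmas); `tdist_le_of_labels_div_eq` — sites whose labels have
  the same quotients by `M` (the same `M`-big-block, p1's `Carriers.Regions.bigBlockOf`) are at distance `≤ d(M − 1)`.
-/

namespace Summit.QuantumFields.Balaban3D.Proofs.CollarCount

open Literature.MathematicalPhysics.QuantumFieldTheory.Balaban1983to89
open B3Taylor310LocalRemainder (tdist_comm tdist_triangle)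
open Finset

/-! ## §1 Natural-number division bookkeeping -/

/-- `Σ (f i / L) ≤ (Σ f i) / L`. [folklore] -/
theorem sum_div_le {ι : Type*} (s : Finset ι) (f : ι → ℕ) (L : ℕ) :
    ∑ i ∈ s, f i / L ≤ (∑ i ∈ s, f i) / L := by
  classical
  induction s using Finset.induction_on with
  | empty => simp
  | insert a s ha ih =>
    rw [Finset.sum_insert ha, Finset.sum_insert ha]
    exact (Nat.add_le_add_left ih _).trans (Nat.add_div_le_add_div _ _ _)

/-! ## §2 One coordinate: `ZMod (n'·L) → ZMod n'`, label `A ↦ A / L` -/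

section OneDim

variable {n n' L : ℕ} [NeZero n] [NeZero n']

/-- One-sided contraction: for labels `B ≤ A`, both torus differences of the quotients are at most those of the labels divided by `L`,
plus one. [folklore] -/
theorem coarse_val_sub_le (hn : n = n' * L) (hL : 0 < L) (a b : ZMod n) (α β : ZMod n') (hα : α.val = a.val / L)
    (hβ : β.val = b.val / L) (hab : b.val ≤ a.val) :
    (α - β).val ≤ (a - b).val / L + 1 ∧ (β - α).val ≤ (b - a).val / L + 1 := by
  have hA : a.val < n := ZMod.val_lt a
  have hαβ : β.val ≤ α.val := by rw [hα, hβ]; exact Nat.div_le_div_right hab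
  have h1 : (α - β).val = α.val - β.val := ZMod.val_sub hαβ
  have h2 : (a - b).val = a.val - b.val := ZMod.val_sub hab
  -- quotient bounds
  -- `(x + y) / L ≤ x / L + y / L + 1`
  have hadd : ∀ x y : ℕ, (x + y) / L ≤ x / L + y / L + 1 := by
    intro x y
    have hx : x < x / L * L + L := Nat.lt_div_mul_add hL
    have hy : y < y / L * L + L := Nat.lt_div_mul_add hL
    have h : x + y < (x / L + y / L + 2) * L := by nlinarith
    have := (Nat.div_lt_iff_lt_mul hL).mpr h
    omega
  have hq1 : a.val / L ≤ (a.val - b.val) / L + b.val / L + 1 := by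
    have := hadd (a.val - b.val) b.val
    rwa [Nat.sub_add_cancel hab] at this
  have hq2 : (a.val - b.val) / L + b.val / L ≤ a.val / L := by
    have := Nat.add_div_le_add_div (a.val - b.val) b.val L
    rwa [Nat.sub_add_cancel hab] at this
  refine ⟨by rw [h1, h2, hα, hβ]; omega, ?_⟩
  -- the other way round the torus
  by_cases hαβe : α = β
  · rw [hαβe, sub_self, ZMod.val_zero]; exact Nat.zero_le _
  have hne : a ≠ b := by
    intro he
    apply hαβe
    apply ZMod.val_injective
    rw [hα, hβ, he]
  have h3 : (β - α).val = n' - (α.val - β.val) := by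
    rw [← neg_sub, ZMod.neg_val, if_neg (sub_ne_zero.mpr (Ne.symm (fun h => hαβe h.symm))), h1]
  have h4 : (b - a).val = n - (a.val - b.val) := by
    rw [← neg_sub, ZMod.neg_val, if_neg (sub_ne_zero.mpr hne), h2]
  have hdiv : n / L = n' := by rw [hn]; exact Nat.mul_div_cancel n' hL
  have hq3 : n' ≤ (n - (a.val - b.val)) / L + (a.val - b.val) / L + 1 := by
    have := hadd (n - (a.val - b.val)) (a.val - b.val)
    have hs : n - (a.val - b.val) + (a.val - b.val) = n := Nat.sub_add_cancel (by omega)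
    rw [hs, hdiv] at this
    exact this
  rw [h3, h4, hα, hβ]
  rw [hα, hβ] at hαβ
  generalize a.val / L = p at hq1 hq2 hαβ ⊢
  generalize b.val / L = q at hq1 hq2 hαβ ⊢
  generalize (a.val - b.val) / L = g at hq1 hq2 hq3 ⊢
  generalize (n - (a.val - b.val)) / L = r at hq3 ⊢
  omega

/-- CONTRACTION, one coordinate: the torus distance of the quotient labels is at most the torus distance of the labels divided by `L`,
plus one. [folklore] -/
theorem coarse_dist_le (hn : n = n' * L) (hL : 0 < L) (a b : ZMod n) (α β : ZMod n') (hα : α.val = a.val / L)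
    (hβ : β.val = b.val / L) :
    min (α - β).val (β - α).val ≤ min (a - b).val (b - a).val / L + 1 := by
  rcases le_total b.val a.val with hab | hab
  · obtain ⟨h1, h2⟩ := coarse_val_sub_le hn hL a b α β hα hβ hab
    rcases le_total (a - b).val (b - a).val with h | h
    · rw [min_eq_left h]; exact (min_le_left _ _).trans h1
    · rw [min_eq_right h]; exact (min_le_right _ _).trans h2
  · obtain ⟨h1, h2⟩ := coarse_val_sub_le hn hL b a β α hβ hα hab
    rcases le_total (a - b).val (b - a).val with h | h
    · rw [min_eq_left h]; exact (min_le_left _ _).trans h2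
    · rw [min_eq_right h]; exact (min_le_right _ _).trans h1

/-- EXPANSION, one coordinate: the torus distance of the labels is at most `L` times that of the quotient labels plus the
block diameter `L − 1`. [folklore] -/
theorem dist_le_coarse (hn : n = n' * L) (hL : 0 < L) (a b : ZMod n) (α β : ZMod n') (hα : α.val = a.val / L)
    (hβ : β.val = b.val / L) :
    min (a - b).val (b - a).val ≤ L * min (α - β).val (β - α).val + (L - 1) := by
  -- one-sided version for labels B ≤ A
  have aux : ∀ (a b : ZMod n) (α β : ZMod n'), α.val = a.val / L → β.val = b.val / L → b.val ≤ a.val →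
      min (a - b).val (b - a).val ≤ L * min (α - β).val (β - α).val + (L - 1) := by
    intro a b α β hα hβ hab
    have hA : a.val < n := ZMod.val_lt a
    have hαβ : β.val ≤ α.val := by rw [hα, hβ]; exact Nat.div_le_div_right hab
    have h1 : (α - β).val = α.val - β.val := ZMod.val_sub hαβ
    have h2 : (a - b).val = a.val - b.val := ZMod.val_sub hab
    have hdA := Nat.div_add_mod a.val L
    have hdB := Nat.div_add_mod b.val L
    have hrA : a.val % L < L := Nat.mod_lt _ hL
    have hrB : b.val % L < L := Nat.mod_lt _ hL
    have hms : L * (a.val / L - b.val / L) = L * (a.val / L) - L * (b.val / L) := Nat.mul_sub _ _ _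
    -- (a − b).val ≤ L·(α − β).val + (L − 1)
    have key1 : (a - b).val ≤ L * (α - β).val + (L - 1) := by
      rw [h2, h1, hα, hβ, hms]; omega
    by_cases hαβe : α = β
    · -- same block: A − B ≤ L − 1
      have h0 : min (α - β).val (β - α).val = 0 := by rw [hαβe, sub_self, ZMod.val_zero, Nat.min_self]
      rw [h0, mul_zero, zero_add]
      have : (α - β).val = 0 := by rw [hαβe, sub_self, ZMod.val_zero]
      have k := key1
      rw [this, mul_zero, zero_add] at k
      exact (min_le_left _ _).trans k
    · have hne : a ≠ b := by
        intro he; apply hαβe; apply ZMod.val_injective; rw [hα, hβ, he]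
      have h3 : (β - α).val = n' - (α.val - β.val) := by
        rw [← neg_sub, ZMod.neg_val, if_neg (sub_ne_zero.mpr (Ne.symm (fun h => hαβe h.symm))), h1]
      have h4 : (b - a).val = n - (a.val - b.val) := by
        rw [← neg_sub, ZMod.neg_val, if_neg (sub_ne_zero.mpr hne), h2]
      have hq3 : a.val / L < n' := by
        rw [Nat.div_lt_iff_lt_mul hL, ← hn]; exact hA
      have hms' : L * (n' - (a.val / L - b.val / L)) = L * n' - L * (a.val / L - b.val / L) := Nat.mul_sub _ _ _
      have key2 : (b - a).val ≤ L * (β - α).val + (L - 1) := by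
        rw [h4, h3, hα, hβ, hms', hms]
        have hLn : n = L * n' := by rw [hn, Nat.mul_comm]
        have hqa : L * (a.val / L) ≤ a.val := Nat.mul_div_le _ _
        have hqa' : L * (a.val / L) ≤ L * n' := Nat.mul_le_mul_left _ hq3.le
        have hqb : L * (b.val / L) ≤ L * (a.val / L) := Nat.mul_le_mul_left _ (by rw [← hα, ← hβ]; exact hαβ)
        omega
      rcases le_total (α - β).val (β - α).val with h | h
      · rw [min_eq_left h]; exact (min_le_left _ _).trans key1
      · rw [min_eq_right h]; exact (min_le_right _ _).trans key2
  rcases le_total b.val a.val with hab | hab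
  · exact aux a b α β hα hβ hab
  · have := aux b a β α hβ hα hab
    rwa [min_comm (b - a).val, min_comm (β - α).val] at this

/-- SAME BIG BLOCK, one coordinate: labels with the same quotient by `M` are at torus distance `≤ M − 1`. [folklore] -/
theorem torDist_le_of_div_eq (a b : ZMod n) {M : ℕ} (hM : 0 < M) (h : a.val / M = b.val / M) :
    min (a - b).val (b - a).val ≤ M - 1 := by
  have hdA := Nat.div_add_mod a.val M
  have hdB := Nat.div_add_mod b.val M
  have hrA : a.val % M < M := Nat.mod_lt _ hM
  have hrB : b.val % M < M := Nat.mod_lt _ hM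
  rcases le_total b.val a.val with hab | hab
  · have : (a - b).val = a.val - b.val := ZMod.val_sub hab
    refine (min_le_left _ _).trans ?_
    rw [this]
    have : M * (a.val / M) = M * (b.val / M) := by rw [h]
    omega
  · have : (b - a).val = b.val - a.val := ZMod.val_sub hab
    refine (min_le_right _ _).trans ?_
    rw [this]
    have : M * (a.val / M) = M * (b.val / M) := by rw [h]
    omega

end OneDim

/-! ## §3 The torus `Site P j`: triangle inequality, contraction and expansion under `blockOf` -/

section Torus

variable {P : Params} {j : ℕ}

/-- **CONTRACTION:** `tdist (blockOf x) (blockOf y) ≤ tdist x y / L + d` (standing range `j + 1 ≤ m + K`). [folklore] -/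
theorem tdist_blockOf_le (hj : j + 1 ≤ P.m + P.K) (x y : Site P j) :
    Site.tdist (blockOf x) (blockOf y) ≤ Site.tdist x y / P.L + P.d := by
  have hL : 0 < P.L := P.L_pos
  have hn : P.sitesPerDir j = P.sitesPerDir (j + 1) * P.L := P.sitesPerDir_eq_mul_succ hj
  have hcoord : ∀ μ : Fin P.d,
      min ((blockOf x) μ - (blockOf y) μ).val ((blockOf y) μ - (blockOf x) μ).val ≤
        min (x μ - y μ).val (y μ - x μ).val / P.L + 1 :=
    fun μ => coarse_dist_le hn hL (x μ) (y μ) _ _ (Site.val_blockOf hj x μ) (Site.val_blockOf hj y μ)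
  unfold Site.tdist
  calc ∑ μ, min ((blockOf x) μ - (blockOf y) μ).val ((blockOf y) μ - (blockOf x) μ).val
      ≤ ∑ μ, (min (x μ - y μ).val (y μ - x μ).val / P.L + 1) := Finset.sum_le_sum fun μ _ => hcoord μ
    _ = ∑ μ, min (x μ - y μ).val (y μ - x μ).val / P.L + P.d := by
        rw [Finset.sum_add_distrib]; simp
    _ ≤ (∑ μ, min (x μ - y μ).val (y μ - x μ).val) / P.L + P.d :=
        Nat.add_le_add_right (sum_div_le _ _ _) _

/-- **EXPANSION:** `tdist x y ≤ L·tdist (blockOf x) (blockOf y) + d(L − 1)` (standing range). [folklore] -/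
theorem tdist_le_blockOf (hj : j + 1 ≤ P.m + P.K) (x y : Site P j) :
    Site.tdist x y ≤ P.L * Site.tdist (blockOf x) (blockOf y) + P.d * (P.L - 1) := by
  have hL : 0 < P.L := P.L_pos
  have hn : P.sitesPerDir j = P.sitesPerDir (j + 1) * P.L := P.sitesPerDir_eq_mul_succ hj
  have hcoord : ∀ μ : Fin P.d, min (x μ - y μ).val (y μ - x μ).val ≤
      P.L * min ((blockOf x) μ - (blockOf y) μ).val ((blockOf y) μ - (blockOf x) μ).val + (P.L - 1) :=
    fun μ => dist_le_coarse hn hL (x μ) (y μ) _ _ (Site.val_blockOf hj x μ) (Site.val_blockOf hj y μ)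
  unfold Site.tdist
  calc ∑ μ, min (x μ - y μ).val (y μ - x μ).val
      ≤ ∑ μ, (P.L * min ((blockOf x) μ - (blockOf y) μ).val ((blockOf y) μ - (blockOf x) μ).val + (P.L - 1)) :=
        Finset.sum_le_sum fun μ _ => hcoord μ
    _ = P.L * ∑ μ, min ((blockOf x) μ - (blockOf y) μ).val ((blockOf y) μ - (blockOf x) μ).val + P.d * (P.L - 1) := by
        rw [Finset.sum_add_distrib, Finset.mul_sum]; simp

/-- SAME BIG BLOCK on the torus: if all coordinate labels of `x, y : Site P j` have the same quotient by `M`, then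
`tdist x y ≤ d(M − 1)`. [folklore] -/
theorem tdist_le_of_labels_div_eq (x y : Site P j) {M : ℕ} (hM : 0 < M) (h : ∀ μ, (x μ).val / M = (y μ).val / M) :
    Site.tdist x y ≤ P.d * (M - 1) := by
  unfold Site.tdist
  calc ∑ μ, min (x μ - y μ).val (y μ - x μ).val ≤ ∑ _μ : Fin P.d, (M - 1) :=
        Finset.sum_le_sum fun μ _ => torDist_le_of_div_eq (x μ) (y μ) hM (h μ)
    _ = P.d * (M - 1) := by simp

end Torus

end Summit.QuantumFields.Balaban3D.Proofs.CollarCount
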